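import Mathlib
import HarnessLib
import HarnessLib.Audit
import Summits.CriticalPhenomena.PercolationContinuityZ3.Theorems.PercNearOneGluingNoHeavyLowerTailHexMSMSEquality
import Summits.CriticalPhenomena.PercolationContinuityZ3.Theorems.PercNearOneGluingNoHeavyLowerTailHexMSMatchOneAxis
import Summits.CriticalPhenomena.PercolationContinuityZ3.Theorems.PercNearOneGluingNoHeavyLowerTailHexMSMatchBlockers

/-!
# Conjecture (MATCH), two dead classes with a singleton class, I: the new candidate (hp-7 gen 70)

Support file for crux `stmt-CriticalPhenomena-4575` (route `PercNearOneGluingNoHeavy`), hull-port seat `prim-hp-7` (generation 70);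
`--supports stmt-CriticalPhenomena-4575`.  No `sorry`, no definition.  Memo: `run/shared/lean/prim/prim-hp-7/FROM-prim-hp-7-g70-MS-EQUALITY.md` §2.

Setting: an antipodal instance `(U, 𝒟, x)`, a two-class dead family `F` (labels in `{ℓ, ℓ+1}`) and a dead `q ∉ F` with `x q = ℓ + 1`
(gen 69's memo singled out `F = P ⊆ dead_ℓ`, i.e. two classes with `#Q = 1`, as the next case of Conjecture (MATCH)).  Part II
(`…HexMSMatchAxisPair`) proves Hall's condition for `cl(P ∪ {q})`; `…HexMSMatchTightInsert` for `cl(F ∪ {q})`, `F` MS-tight.  Key step here: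
* `exists_candidate_notMem_cl_diffs` — **if `F` is MS-tight (a twisted product over its pivot `c`: all `(c \\ e₁) ∪ e₂` are members and every
  difference splits along `c`, cf. `…HexMSMSEquality`), then `q \\ c`, `c \\ q` or `c ∩ q` is a candidate of `q` or of `c` outside `ΔF ∪ co ΔF`.**
  (`q \\ c ∈ co ΔF` would give a dead member disjoint from `c`, `c \\ q ∈ co ΔF` one covering `U` with `c`; `q \\ c ∈ ΔF` forces `c ∪ q ∈ F`,
  `c \\ q ∈ ΔF` forces `c ∩ q ∈ F`, both force `q ∈ F`; one of them plus the other difference being a member — a blocker, labels `ℓ+5`/`ℓ+2`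
  by `…HexMSMatchBlockers` — exhibits `q` as a far meet/join or a same-label member difference, contradicting deadness; two blockers make
  `c ∩ q` an absent far product of `c`.)
* `empty_notMem_of_dead`, `card_cl_diffs_eq_two_mul` (`#(ΔP ∪ co ΔP) = 2 #ΔP` for intersecting `P`), counting helpers, `ZMod 6` arithmetic,
  and invariance of `gen`/`symGen`/`dead`/`farProducts`/`candidates`/`MatchHall` under the label reflection `x ↦ -x`.
-/

namespace Summit.CriticalPhenomena.PercolationContinuityZ3.Theorems

namespace GeneratedDonors

open Finset FinsetFamily

variable {α : Type*} [DecidableEq α]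

section AxisPlusOne

/-! ### Two dead classes with `#Q = 1`: Hall for `cl(P ∪ {q})`, `P ⊆ dead_ℓ`, `q ∈ dead_{ℓ+1}` -/

variable {U : Finset α} {𝒟 : Finset (Finset α)} {x : Finset α → ZMod 6}

/-- If some member is dead then `∅ ∉ 𝒟` (a member `s` is `s ∪ ∅` and `s ∩ U`, one of which is a far product). -/
theorem empty_notMem_of_dead (hU : ∀ a ∈ 𝒟, a ⊆ U) (hco : ∀ a ∈ 𝒟, U \ a ∈ 𝒟)
    (hanti : ∀ a ∈ 𝒟, x (U \ a) = x a + 3) {s : Finset α} (hs : s ∈ dead U 𝒟 x) : (∅ : Finset α) ∉ 𝒟 := by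
  intro h0
  have hsD : s ∈ 𝒟 := (mem_filter.mp hs).1
  apply (mem_filter.mp hs).2
  by_cases hc : Close (x s) (x ∅)
  · -- `U = U \ ∅` is far from `s`, and `s = s ∩ U`
    have hfar : ¬ Close (x s) (x (U \ ∅)) := by
      rw [hanti _ h0, close_comm, close_add_three_iff_not_close, not_not, close_comm]; exact hc
    refine farProducts_subset_symGen hU hco hanti hsD (mem_farProducts.mpr ⟨U \ ∅, hco _ h0, hfar, Or.inl ?_⟩)
    rw [sdiff_empty, inter_eq_left.mpr (hU s hsD)]
  · exact farProducts_subset_symGen hU hco hanti hsD (mem_farProducts.mpr ⟨∅, h0, hc, Or.inr (union_empty s).symm⟩)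

/-- For an intersecting family of subsets of `U`, `#(ΔP ∪ co ΔP) = 2 #ΔP`. -/
theorem card_cl_diffs_eq_two_mul {P : Finset (Finset α)} (hPU : ∀ f ∈ P, f ⊆ U)
    (hint : ∀ f ∈ P, ∀ g ∈ P, (f ∩ g).Nonempty) :
    #((P \\ P) ∪ (P \\ P).image (fun z => U \ z)) = 2 * #(P \\ P) := by
  have hdisj : Disjoint (P \\ P) ((P \\ P).image (fun z => U \ z)) := by
    rw [disjoint_left]
    intro e he he'
    obtain ⟨e', he'', hee⟩ := mem_image.mp he'
    rw [Finset.mem_diffs] at he he''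
    obtain ⟨f, hf, g, hg, rfl⟩ := he
    obtain ⟨f', hf', g', hg', rfl⟩ := he''
    obtain ⟨i, hi⟩ := hint g hg g' hg'
    rw [mem_inter] at hi
    have h1 : i ∈ U \ (f' \ g') := by
      rw [mem_sdiff, mem_sdiff, not_and, not_not]
      exact ⟨hPU g hg hi.1, fun _ => hi.2⟩
    rw [hee, mem_sdiff] at h1
    exact h1.2 hi.1
  have hinj : Set.InjOn (fun z : Finset α => U \ z) ↑(P \\ P) := by
    intro p hp p' hp' hpq
    have hpU : p ⊆ U := by
      obtain ⟨f, hf, g, _, rfl⟩ := Finset.mem_diffs.mp (mem_coe.mp hp); exact sdiff_subset.trans (hPU f hf)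
    have hqU : p' ⊆ U := by
      obtain ⟨f, hf, g, _, rfl⟩ := Finset.mem_diffs.mp (mem_coe.mp hp'); exact sdiff_subset.trans (hPU f hf)
    have e := congrArg (fun t => U \ t) hpq
    simp only [Finset.sdiff_sdiff_eq_self hpU, Finset.sdiff_sdiff_eq_self hqU] at e
    exact e
  rw [card_union_of_disjoint hdisj, card_image_of_injOn hinj]
  omega

/-! #### Label arithmetic in `ZMod 6` and Boolean identities (separate declarations keep the main proof light) -/
/-- `ℓ+1` is far from `t+3` for `t ∈ {ℓ, ℓ+1}`. -/
theorem notClose_add_one_add_three_of_pair {s t : ZMod 6} (h : t = s ∨ t = s + 1) : ¬ Close (s + 1) (t + 3) := by revert s t; decide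
/-- `t ∈ {ℓ, ℓ+1}` is far from `ℓ+1+3`. -/
theorem notClose_add_one_add_three_of_pair' {s t : ZMod 6} (h : t = s ∨ t = s + 1) : ¬ Close t (s + 1 + 3) := by revert s t; decide
/-- `s` and `s + 2` are far. -/
theorem notClose_add_two (s : ZMod 6) : ¬ Close s (s + 2) := by revert s; decide
/-- `s + 5 + 3 = s + 2` in `ZMod 6`. -/ theorem add_five_add_three_eq (s : ZMod 6) : s + 5 + 3 = s + 2 := by revert s; decide
/-- `s + 1 ≠ s` in `ZMod 6`. -/
theorem add_one_ne_self (s : ZMod 6) : s + 1 ≠ s := by revert s; decide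
/-- `s + 3 + 3 = s` in `ZMod 6`. -/
theorem add_three_add_three (s : ZMod 6) : s + 3 + 3 = s := by revert s; decide
/-- `-(s + 3) = -s + 3` in `ZMod 6`. -/
theorem neg_add_three (s : ZMod 6) : -(s + 3) = -s + 3 := by revert s; decide

/-- `c ∩ p = c \ (c \ p)`. -/
theorem inter_eq_sdiff_sdiff (c p : Finset α) : c ∩ p = c \ (c \ p) := by ext i; simp only [mem_inter, mem_sdiff]; grind
/-- `(q \ c) \ c = q \ c`. -/
theorem sdiff_sdiff_same (q c : Finset α) : (q \ c) \ c = q \ c := by ext i; simp only [mem_sdiff]; grind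
/-- `(c \ ∅) ∪ (q \ c) = c ∪ q`. -/
theorem sdiff_empty_union_sdiff (c q : Finset α) : (c \ ∅) ∪ (q \ c) = c ∪ q := by ext i; simp only [mem_union, mem_sdiff]; grind
/-- `(c \ q) ∩ c = c \ q`. -/
theorem sdiff_inter_same (c q : Finset α) : (c \ q) ∩ c = c \ q := by ext i; simp only [mem_sdiff, mem_inter]; grind
/-- `(c \ (c \ q)) ∪ ∅ = c ∩ q`. -/
theorem sdiff_sdiff_union_empty (c q : Finset α) : (c \ (c \ q)) ∪ ∅ = c ∩ q := by ext i; simp only [mem_union, mem_sdiff, mem_inter]; grind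
/-- `(c ∩ q) ∪ (q \ c) = q`. -/
theorem inter_union_sdiff_eq (c q : Finset α) : (c ∩ q) ∪ (q \ c) = q := by ext i; simp only [mem_union, mem_inter, mem_sdiff]; grind
/-- `q \ (c ∩ q) = q \ c`. -/
theorem sdiff_inter_eq_sdiff (q c : Finset α) : q \ (c ∩ q) = q \ c := by ext i; simp only [mem_inter, mem_sdiff]; grind
/-- `(c ∪ q) \ q = c \ q`. -/
theorem union_sdiff_eq_sdiff (c q : Finset α) : (c ∪ q) \ q = c \ q := by ext i; simp only [mem_union, mem_sdiff]; grind
/-- `(c \ (c \ q)) ∪ (q \ c) = q`. -/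
theorem sdiff_sdiff_union_sdiff (c q : Finset α) : (c \ (c \ q)) ∪ (q \ c) = q := by ext i; simp only [mem_union, mem_sdiff]; grind
/-- `q = (c ∪ q) ∩ (U \ (c \ q))` for `q, c ⊆ U`. -/
theorem eq_union_inter_compl_sdiff {U c q : Finset α} (hqU : q ⊆ U) (hcU : c ⊆ U) : q = (c ∪ q) ∩ (U \ (c \ q)) := by
  ext i; simp only [mem_union, mem_inter, mem_sdiff]
  have := @hqU i; have := @hcU i; grind
/-- From `c \ p = (c ∩ q) ∩ c`: `c \ (c \ p) = c \ q`. -/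
theorem sdiff_sdiff_inter_inter (c p q : Finset α) (h : c \ p = (c ∩ q) ∩ c) : c \ (c \ p) = c \ q := by
  rw [h]; ext i; simp only [mem_sdiff, mem_inter]; grind

/-- If every point of `U` outside `e` lies in `c` (and `e ⊆ U`) then `e \ c = U \ c`. -/
theorem sdiff_eq_compl_sdiff_of {U e c : Finset α} (heU : e ⊆ U) (h : ∀ i, i ∈ U → i ∉ e → i ∈ c) : e \ c = U \ c := by
  ext i; simp only [mem_sdiff]
  constructor
  · exact fun h' => ⟨heU h'.1, h'.2⟩
  · intro ⟨hiU, hic⟩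
    exact ⟨by_contra fun hie => hic (h i hiU hie), hic⟩

/-- If `p \ c = U \ c` with `p, c ⊆ U` then `p ∪ c = U`. -/
theorem union_eq_of_sdiff_eq_compl_sdiff {U p c : Finset α} (hpU : p ⊆ U) (hcU : c ⊆ U) (hpc : p \ c = U \ c) : p ∪ c = U := by
  ext i; simp only [mem_union]
  constructor
  · rintro (h | h)
    · exact hpU h
    · exact hcU h
  · intro hiU
    by_cases hic : i ∈ c
    · exact Or.inr hic
    · have : i ∈ p \ c := by rw [hpc]; exact mem_sdiff.mpr ⟨hiU, hic⟩
      exact Or.inl (mem_sdiff.mp this).1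

/-- **The new candidate.**  Let `F ⊆ dead` be a two-class family (labels in `{ℓ, ℓ+1}`) which is a twisted product over its pivot `c ∈ F`
(coordinate families `{c \ f}`, `{f \ c}`; every difference splits along `c`), and let `q ∉ F` be dead with `x q = ℓ + 1`.  Then `q` or `c` has a
candidate outside `ΔF ∪ co ΔF`: one of `q \ c`, `c \ q`, `c ∩ q`. -/
theorem exists_candidate_notMem_cl_diffs (hU : ∀ a ∈ 𝒟, a ⊆ U) (hco : ∀ a ∈ 𝒟, U \ a ∈ 𝒟)
    (hanti : ∀ a ∈ 𝒟, x (U \ a) = x a + 3) {F : Finset (Finset α)} (hF : F ⊆ dead U 𝒟 x) {ℓ : ZMod 6}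
    (hFlab : ∀ f ∈ F, x f = ℓ ∨ x f = ℓ + 1) {q : Finset α} (hq : q ∈ dead U 𝒟 x) (hqlab : x q = ℓ + 1) (hqF : q ∉ F)
    {c : Finset α} (hcF : c ∈ F)
    (htp : ∀ e₁ ∈ F.image (c \ ·), ∀ e₂ ∈ F.image (· \ c), (c \ e₁) ∪ e₂ ∈ F)
    (hsplit : ∀ e ∈ F \\ F, e ∩ c ∈ F.image (c \ ·) ∧ e \ c ∈ F.image (· \ c)) :
    ∃ w : Finset α, (w ∈ candidates 𝒟 x q ∨ w ∈ candidates 𝒟 x c) ∧ w ∉ F \\ F ∧ w ∉ (F \\ F).image (fun z => U \ z) := by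
  have hFD : ∀ f ∈ F, f ∈ 𝒟 := fun f hf => (mem_filter.mp (hF hf)).1
  have hFdead : ∀ f ∈ F, f ∉ symGen U 𝒟 x := fun f hf => (mem_filter.mp (hF hf)).2
  have hc : c ∈ dead U 𝒟 x := hF hcF
  have hcD : c ∈ 𝒟 := hFD c hcF
  have hqD : q ∈ 𝒟 := (mem_filter.mp hq).1
  have hqdead : q ∉ symGen U 𝒟 x := (mem_filter.mp hq).2
  have hcU : c ⊆ U := hU c hcD
  have hqU : q ⊆ U := hU q hqD
  have hqlab' : x q = ℓ ∨ x q = ℓ + 1 := Or.inr hqlab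
  have h0E₁ : ∅ ∈ F.image (c \ ·) := mem_image.mpr ⟨c, hcF, Finset.sdiff_self c⟩
  have h0E₂ : ∅ ∈ F.image (· \ c) := mem_image.mpr ⟨c, hcF, Finset.sdiff_self c⟩
  -- geometry of `F ∪ {q}`: pairwise close labels, so intersecting and non-covering
  have hint : ∀ f ∈ F, (c ∩ f).Nonempty := fun f hf =>
    inter_nonempty_of_dead_of_close hc (hFD f hf) (close_of_mem_pair (hFlab c hcF) (hFlab f hf))
  have hncov : ∀ f ∈ F, f ∪ c ≠ U := fun f hf =>
    union_ne_of_dead_of_close hU hco hanti (hF hf) hcD (close_of_mem_pair (hFlab f hf) (hFlab c hcF))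
  -- (L3) `q \ c ∉ co ΔF`
  have L3 : q \ c ∉ (F \\ F).image (fun z => U \ z) := by
    intro h
    obtain ⟨e, he, hee⟩ := mem_image.mp h
    obtain ⟨p, hp, hpe⟩ := mem_image.mp (hsplit e he).1
    -- `e ⊇ c`, so `e ∩ c = c = c \ p`, i.e. `c ∩ p = ∅`
    have hce : e ∩ c = c := by
      ext i; simp only [mem_inter]
      constructor
      · exact fun h => h.2
      · intro hic
        refine ⟨?_, hic⟩
        by_contra hie
        have : i ∈ U \ e := mem_sdiff.mpr ⟨hcU hic, hie⟩
        rw [hee, mem_sdiff] at this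
        exact this.2 hic
    have hcp : (c ∩ p).Nonempty := hint p hp
    rw [nonempty_iff_ne_empty] at hcp
    apply hcp
    have hpe' : c \ p = c := (show c \ p = e ∩ c from hpe).trans hce
    rw [inter_eq_sdiff_sdiff, hpe', Finset.sdiff_self]
  -- a member of `co ΔF` containing `U \ c` forces a covering pair: (L4) `c \ q ∉ co ΔF`
  have hcov : ∀ e ∈ F \\ F, (∀ i, i ∈ U → i ∉ e → i ∈ c) → False := by
    intro e he h
    obtain ⟨p, hp, hpe⟩ := mem_image.mp (hsplit e he).2
    have heU : e ⊆ U := by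
      obtain ⟨f, hf, g, _, rfl⟩ := Finset.mem_diffs.mp he; exact sdiff_subset.trans (hU f (hFD f hf))
    exact hncov p hp (union_eq_of_sdiff_eq_compl_sdiff (hU p (hFD p hp)) hcU
      ((show p \ c = e \ c from hpe).trans (sdiff_eq_compl_sdiff_of heU h)))
  have L4 : c \ q ∉ (F \\ F).image (fun z => U \ z) := by
    intro h
    obtain ⟨e, he, hee⟩ := mem_image.mp h
    refine hcov e he fun i hiU hie => ?_
    have : i ∈ U \ e := mem_sdiff.mpr ⟨hiU, hie⟩
    rw [hee, mem_sdiff] at this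
    exact this.1
  -- (L5) `q \ c ∈ ΔF ⟹ c ∪ q ∈ F`;  (L6) `c \ q ∈ ΔF ⟹ c ∩ q ∈ F`
  have L5 : q \ c ∈ F \\ F → c ∪ q ∈ F := fun h => by
    have h2 := (hsplit _ h).2
    rw [sdiff_sdiff_same] at h2
    have h3 := htp _ h0E₁ _ h2
    rwa [sdiff_empty_union_sdiff] at h3
  have L6 : c \ q ∈ F \\ F → c ∩ q ∈ F := fun h => by
    have h1 := (hsplit _ h).1
    rw [sdiff_inter_same] at h1
    have h3 := htp _ h1 _ h0E₂
    rwa [sdiff_sdiff_union_empty] at h3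
  -- far pairs: `q` with `U \ c` (labels ℓ+1 vs ℓ+3 / ℓ+4), `c` with `U \ q` (labels ℓ / ℓ+1 vs ℓ+4)
  have hfar_q : ¬ Close (x q) (x (U \ c)) := by
    rw [hanti c hcD, hqlab]; exact notClose_add_one_add_three_of_pair (hFlab c hcF)
  have hfar_c : ¬ Close (x c) (x (U \ q)) := by
    rw [hanti q hqD, hqlab]; exact notClose_add_one_add_three_of_pair' (hFlab c hcF)
  have hqc_eq : q \ c = q ∩ (U \ c) := by
    have h1 := sdiff_univ_compl_eq_inter (U := U) (f := U \ c) hqU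
    rwa [Finset.sdiff_sdiff_eq_self hcU] at h1
  have hcq_eq : c \ q = c ∩ (U \ q) := by
    have h1 := sdiff_univ_compl_eq_inter (U := U) (f := U \ q) hcU
    rwa [Finset.sdiff_sdiff_eq_self hqU] at h1
  have hqc_fp : q \ c ∈ farProducts 𝒟 x q :=
    mem_farProducts.mpr ⟨U \ c, hco c hcD, hfar_q, Or.inl hqc_eq⟩
  have hcq_fp : c \ q ∈ farProducts 𝒟 x c :=
    mem_farProducts.mpr ⟨U \ q, hco q hqD, hfar_c, Or.inl hcq_eq⟩
  -- same-label differences are never members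
  have hsame : ∀ {s s' : Finset α}, s ∈ 𝒟 → s' ∈ 𝒟 → s ∉ symGen U 𝒟 x → s' ∉ symGen U 𝒟 x → x s = x s' → s \ s' ∉ 𝒟 :=
    fun hs hs' hd hd' hl => (sdiff_notMem_of_dead_of_label_eq hU hco hanti hs hs' hd hd' hl).2
  by_cases A1 : q \ c ∉ 𝒟 ∧ q \ c ∉ F \\ F
  · refine ⟨q \ c, Or.inl ?_, A1.2, L3⟩
    unfold candidates; exact mem_sdiff.mpr ⟨hqc_fp, A1.1⟩
  by_cases A2 : c \ q ∉ 𝒟 ∧ c \ q ∉ F \\ F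
  · refine ⟨c \ q, Or.inr ?_, A2.2, L4⟩
    unfold candidates; exact mem_sdiff.mpr ⟨hcq_fp, A2.1⟩
  rw [not_and_or, not_not, not_not] at A1 A2
  -- if a cross difference with `q` is a member, `c` must have label `ℓ` (same-label differences are never members)
  have hcl_of_mem : c \ q ∈ 𝒟 ∨ q \ c ∈ 𝒟 → x c = ℓ := by
    intro h
    rcases hFlab c hcF with h0 | h1
    · exact h0
    · exfalso
      rcases h with h | h
      · exact hsame hcD hqD (hFdead c hcF) hqdead (by rw [h1, hqlab]) h
      · exact hsame hqD hcD hqdead (hFdead c hcF) (by rw [h1, hqlab]) h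
  rcases A1 with hγ' | hqc
  · have hcl : x c = ℓ := hcl_of_mem (Or.inr hγ')
    have hlab : x q = x c + 1 := by rw [hqlab, hcl]
    rcases A2 with hγ | hcq
    · -- both blockers: `w = c ∩ q`
      have habs : c ∩ q ∉ 𝒟 := inter_notMem_of_both_sdiff_mem hU hco hanti hc hq hlab hγ hγ'
      refine ⟨c ∩ q, Or.inr (inter_mem_candidates_of_sdiff_mem hU hco hanti hc hq hlab hγ habs), ?_, ?_⟩
      · -- `c ∩ q ∈ ΔF` would put the (alive) blocker `c \ q` in `F`
        intro h
        obtain ⟨p, hp, hpe⟩ := mem_image.mp (hsplit _ h).1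
        have hmem : c ∩ p ∈ F := by
          have h3 := htp _ (mem_image_of_mem _ hp) _ h0E₂
          rwa [sdiff_sdiff_union_empty] at h3
        have e3 : c ∩ p = c \ q := by
          rw [inter_eq_sdiff_sdiff]; exact sdiff_sdiff_inter_inter c p q hpe
        rw [e3] at hmem
        exact hFdead _ hmem (sdiff_mem_symGen_of_adjacent hU hco hanti hcD hqD hlab)
      · -- `c ∩ q ∈ co ΔF` would make some `p ∪ c = U`
        intro h
        obtain ⟨e, he, hee⟩ := mem_image.mp h
        refine hcov e he fun i hiU hie => ?_
        have : i ∈ U \ e := mem_sdiff.mpr ⟨hiU, hie⟩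
        rw [hee, mem_inter] at this
        exact this.1
    · -- `q \ c ∈ 𝒟` and `c ∩ q ∈ F`: `q = (c ∩ q) ∪ (q \ c)` is a far join, or `q \ (c ∩ q)` a same-label member difference
      exfalso
      have hm : c ∩ q ∈ F := L6 hcq
      rcases hFlab _ hm with hm0 | hm1
      · have hl := label_sdiff_of_dead_adjacent' hU hco hanti hc hq hlab hγ'
        have hfar : ¬ Close (x (c ∩ q)) (x (q \ c)) := by
          rw [hm0, hl, hcl]; exact notClose_add_two ℓ
        have h := union_mem_symGen_of_not_close hU hco hanti (hFD _ hm) hγ' hfar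
        rw [inter_union_sdiff_eq] at h
        exact hqdead h
      · have h := hsame hqD (hFD _ hm) hqdead (hFdead _ hm) (by rw [hqlab, hm1])
        rw [sdiff_inter_eq_sdiff] at h
        exact h hγ'
  · rcases A2 with hγ | hcq
    · -- `c \ q ∈ 𝒟` and `c ∪ q ∈ F`: `q = (c ∪ q) ∩ (U \ (c \ q))` is a far meet, or `(c ∪ q) \ q` a same-label member difference
      exfalso
      have hcl : x c = ℓ := hcl_of_mem (Or.inl hγ)
      have hlab : x q = x c + 1 := by rw [hqlab, hcl]
      have hm : c ∪ q ∈ F := L5 hqc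
      rcases hFlab _ hm with hm0 | hm1
      · have hl := label_sdiff_of_dead_adjacent hU hco hanti hc hq hlab hγ
        have hfar : ¬ Close (x (c ∪ q)) (x (U \ (c \ q))) := by
          rw [hm0, hanti _ hγ, hl, hcl, add_five_add_three_eq]; exact notClose_add_two ℓ
        have h := farProducts_subset_symGen hU hco hanti (hFD _ hm)
          (mem_farProducts.mpr ⟨U \ (c \ q), hco _ hγ, hfar, Or.inl (eq_union_inter_compl_sdiff hqU hcU)⟩)
        exact hqdead h
      · have h := hsame (hFD _ hm) hqD (hFdead _ hm) hqdead (by rw [hm1, hqlab])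
        rw [union_sdiff_eq_sdiff] at h
        exact h hγ
    · -- `c ∪ q ∈ F` and `c ∩ q ∈ F`: then `q ∈ F`
      exfalso
      apply hqF
      have h2 := (hsplit _ hqc).2
      rw [sdiff_sdiff_same] at h2
      have h1 := (hsplit _ hcq).1
      rw [sdiff_inter_same] at h1
      have h3 := htp _ h1 _ h2
      rwa [sdiff_sdiff_union_sdiff] at h3

/-- Counting helper: a pool `X ⊆ N` plus a new complementary pair `w, U \ w ∈ N \ X` gives `#X + 2 ≤ #N`. -/
theorem card_add_two_le_card_of_pair {U : Finset α} {X N : Finset (Finset α)} {w : Finset α} (hXN : X ⊆ N) (hw : w ∈ N)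
    (hcw : U \ w ∈ N) (hwX : w ∉ X) (hcwX : U \ w ∉ X) (hne : w ≠ U \ w) : #X + 2 ≤ #N := by
  have hsub : X ∪ {w, U \ w} ⊆ N := by
    intro e he
    rcases mem_union.mp he with he | he
    · exact hXN he
    · rw [mem_insert, mem_singleton] at he
      rcases he with rfl | rfl
      · exact hw
      · exact hcw
  have hdisj : Disjoint X {w, U \ w} := by
    rw [disjoint_right]
    intro e he
    rw [mem_insert, mem_singleton] at he
    rcases he with rfl | rfl
    · exact hwX
    · exact hcwX
  have h1 := card_le_card hsub
  rw [card_union_of_disjoint hdisj, card_pair hne] at h1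
  exact h1

/-- In an instance with a dead member `q`, a candidate `w` is never its own complement (`U ≠ ∅`). -/
theorem ne_compl_of_dead {U : Finset α} {𝒟 : Finset (Finset α)} {x : Finset α → ZMod 6} (hU : ∀ a ∈ 𝒟, a ⊆ U)
    {q : Finset α} (hq : q ∈ dead U 𝒟 x) (w : Finset α) : w ≠ U \ w := by
  intro h
  have hqD : q ∈ 𝒟 := (mem_filter.mp hq).1
  obtain ⟨i, hi⟩ := inter_nonempty_of_dead_of_close hq hqD (Or.inl rfl)
  have hiU : i ∈ U := hU q hqD (mem_inter.mp hi).1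
  by_cases hiw : i ∈ w
  · have h' := hiw; rw [h, mem_sdiff] at h'; exact h'.2 hiw
  · have h' : i ∈ U \ w := mem_sdiff.mpr ⟨hiU, hiw⟩
    rw [← h] at h'; exact hiw h'

end AxisPlusOne

section Negation

/-! ### Label reflection `x ↦ -x` preserves every notion (so the extra pair may also sit at `ℓ + 2` / `ℓ + 5`) -/

variable {U : Finset α} {𝒟 : Finset (Finset α)} {x : Finset α → ZMod 6}

/-- `Close` is invariant under negating both labels. -/
theorem close_neg_iff (s t : ZMod 6) : Close (-s) (-t) ↔ Close s t := by
  revert s t; decide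

/-- `gen` is invariant under `x ↦ -x`. -/
theorem gen_neg (𝒟 : Finset (Finset α)) (x : Finset α → ZMod 6) : gen 𝒟 (fun s => -x s) = gen 𝒟 x := by
  unfold gen
  rw [filter_congr (fun p _ => close_neg_iff (x p.1) (x p.2))]

/-- `symGen` is invariant under `x ↦ -x`. -/
theorem symGen_neg (U : Finset α) (𝒟 : Finset (Finset α)) (x : Finset α → ZMod 6) :
    symGen U 𝒟 (fun s => -x s) = symGen U 𝒟 x := by
  unfold symGen; rw [gen_neg]

/-- `dead` is invariant under `x ↦ -x`. -/
theorem dead_neg (U : Finset α) (𝒟 : Finset (Finset α)) (x : Finset α → ZMod 6) :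
    dead U 𝒟 (fun s => -x s) = dead U 𝒟 x := by
  unfold dead; rw [symGen_neg]

/-- `farProducts` is invariant under `x ↦ -x`. -/
theorem farProducts_neg (𝒟 : Finset (Finset α)) (x : Finset α → ZMod 6) (s : Finset α) :
    farProducts 𝒟 (fun s => -x s) s = farProducts 𝒟 x s := by
  unfold farProducts
  rw [filter_congr (fun d _ => not_congr (close_neg_iff (x s) (x d)))]

/-- `candidates` is invariant under `x ↦ -x`. -/
theorem candidates_neg (𝒟 : Finset (Finset α)) (x : Finset α → ZMod 6) :
    candidates 𝒟 (fun s => -x s) = candidates 𝒟 x := by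
  funext s; unfold candidates; rw [farProducts_neg]

/-- `MatchHall` is invariant under `x ↦ -x`. -/
theorem matchHall_neg_iff (U : Finset α) (𝒟 : Finset (Finset α)) (x : Finset α → ZMod 6) :
    MatchHall U 𝒟 (fun s => -x s) ↔ MatchHall U 𝒟 x := by
  unfold MatchHall; rw [dead_neg, candidates_neg]

end Negation

end GeneratedDonors

end Summit.CriticalPhenomena.PercolationContinuityZ3.Theorems
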